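import Summits.Ventures.HodgeRepro2.T5SplitUnitary
import Summits.Ventures.HodgeRepro2.T5CongruenceConjugation
import Summits.Ventures.HodgeRepro2.T5SplitPlaceHecke
import Summits.Ventures.HodgeRepro2.T5SphericalMultiplicityOneGLn
import Summits.Ventures.HodgeRepro2.T5HeckeAdjointGLn

/-!
# T5SplitPlaceHyperspecial — the hyperspecial subgroup of `U_n(F × F)` and its Hecke algebra

Blind cell pub-hodge-repro2, seat p8, Tier-5 kernel support. p3's T5SplitUnitary (p395375) holds the split
dictionary: over the split algebra `SplitAlg F = F × F` with the swap involution,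
`unitaryGroupEquivGL : U_n(F × F) ≃* GL_n(F)` (`g ↦ fst g`, inverse `A ↦ (A, (A⁻¹)ᵀ)`). CHECK-N3 §19.1 row 5
leaves in prose «the image of the hyperspecial `K_v` under `U(V_v) ≅ GL_n(F_v)` at a split place». This file
adds the INTEGRAL layer and consumes the isomorphism in the Hecke files (nothing of T5SplitUnitary is
re-declared):

* `hyperspecialSplit R : Subgroup (U_n(F × F))` — the elements whose image in `GL_n(F)` lies in `GL_n(R)`
  (`comap`, so T5SplitPlaceHecke's hypothesis `he` is `Subgroup.mem_comap`);
* `mem_hyperspecialSplit_iff` — THE HONEST CHARACTERISATION: `g ∈ hyperspecialSplit R` iff BOTH coordinate matrices of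
  `g` are entrywise `R`-integral, i.e. `hyperspecialSplit R = U_n(F × F) ∩ GL_n(R × R)`, the stabiliser of the
  lattice `(R × R)^n` (T5CongruenceConjugation's `mem_range_of_map_eq` for `⇐`; `snd g = ((fst g)⁻¹)ᵀ` for `⇒`);
* for `R` a DVR with finite residue field and `F = Frac R`: `finite_orbit_hyperspecialSplit`,
  `heckeAlgebra_mul_comm_hyperspecialSplit` (`H(U_n(F × F), K)` IS COMMUTATIVE — no hypothesis),
  `finrank_invariants_eq_one_hyperspecialSplit` (spherical multiplicity one) — T5GelfandTransport /
  T5SplitPlaceHecke / T5SphericalMultiplicityOneGLn along `unitaryGroupEquivGL`.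

That `E ⊗_F F_v ≅ F_v × F_v` with the swap involution at a split place, and that the record's `K_v` is the
stabiliser of a self-dual lattice `(𝒪_v × 𝒪_v)^n` in a suitable basis, are the readings of the printed setting.
-/

namespace Summit.Ventures.HodgeRepro2.T5SplitPlaceHyperspecial

open Summit.Ventures.HodgeRepro2 Matrix

section Integral

variable (R : Type*) [CommRing R] {F : Type*} [Field F] [Algebra R F] {ι : Type*} [Fintype ι]
  [DecidableEq ι]

/-- The hyperspecial subgroup of `U_n(F × F)`: the elements whose image in `GL_n(F)` is integral. -/
def hyperspecialSplit : Subgroup (Matrix.unitaryGroup ι (T5SplitUnitary.SplitAlg F)) :=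
  (Matrix.GeneralLinearGroup.map (algebraMap R F)).range.comap
    (T5SplitUnitary.unitaryGroupEquivGL :
      Matrix.unitaryGroup ι (T5SplitUnitary.SplitAlg F) ≃* GL ι F).toMonoidHom

/-- Membership by definition: the image under `unitaryGroupEquivGL` lies in `GL_n(R)`. -/
theorem mem_hyperspecialSplit_iff_map (g : Matrix.unitaryGroup ι (T5SplitUnitary.SplitAlg F)) :
    g ∈ hyperspecialSplit R ↔
      T5SplitUnitary.unitaryGroupEquivGL g ∈ (Matrix.GeneralLinearGroup.map (algebraMap R F)).range :=
  Subgroup.mem_comap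

/-- The hypothesis `he` of T5SplitPlaceHecke for `e = unitaryGroupEquivGL`, `K' = hyperspecialSplit R`. -/
theorem unitaryGroupEquivGL_mem_iff (x : Matrix.unitaryGroup ι (T5SplitUnitary.SplitAlg F)) :
    T5SplitUnitary.unitaryGroupEquivGL x ∈ (Matrix.GeneralLinearGroup.map (algebraMap R F)).range ↔
      x ∈ hyperspecialSplit R :=
  (mem_hyperspecialSplit_iff_map R x).symm

variable {R}

/-- An integral unit has integral entries. -/
theorem isInteger_apply_of_mem_range {h : GL ι F}
    (hh : h ∈ (Matrix.GeneralLinearGroup.map (algebraMap R F)).range) (i j : ι) :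
    IsLocalization.IsInteger R ((h : Matrix ι ι F) i j) := by
  obtain ⟨h₀, rfl⟩ := hh
  exact ⟨(h₀ : Matrix ι ι R) i j, rfl⟩

/-- THE HONEST CHARACTERISATION: `g ∈ hyperspecialSplit R` iff both coordinate matrices `fst g`, `snd g` are
entrywise `R`-integral (`hyperspecialSplit R = U_n(F × F) ∩ GL_n(R × R)`). -/
theorem mem_hyperspecialSplit_iff [IsDomain R] [IsFractionRing R F]
    (g : Matrix.unitaryGroup ι (T5SplitUnitary.SplitAlg F)) :
    g ∈ hyperspecialSplit R ↔
      (∀ i j, IsLocalization.IsInteger R (T5SplitUnitary.fst (g : Matrix ι ι (T5SplitUnitary.SplitAlg F)) i j)) ∧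
      (∀ i j, IsLocalization.IsInteger R (T5SplitUnitary.snd (g : Matrix ι ι (T5SplitUnitary.SplitAlg F)) i j)) := by
  rw [mem_hyperspecialSplit_iff_map]
  constructor
  · intro hg
    refine ⟨fun i j => ?_, fun i j => ?_⟩
    · have := isInteger_apply_of_mem_range hg i j
      rwa [T5SplitUnitary.coe_unitaryGroupEquivGL_apply] at this
    · have hinv : (T5SplitUnitary.unitaryGroupEquivGL g)⁻¹ ∈
          (Matrix.GeneralLinearGroup.map (algebraMap R F)).range := inv_mem hg
      have := isInteger_apply_of_mem_range hinv j i
      have hc : ((T5SplitUnitary.unitaryGroupEquivGL g)⁻¹ : GL ι F) = (T5SplitUnitary.toGL g)⁻¹ := rfl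
      rw [hc, T5SplitUnitary.coe_toGL_inv, Matrix.transpose_apply] at this
      exact this
  · rintro ⟨h1, h2⟩
    choose M hM using h1
    choose M' hM' using h2
    refine T5CongruenceConjugation.mem_range_of_map_eq (IsFractionRing.injective R F)
      (T5SplitUnitary.unitaryGroupEquivGL g) (Matrix.of M) (Matrix.of M')ᵀ ?_ ?_
    · ext i j
      rw [T5SplitUnitary.coe_unitaryGroupEquivGL_apply, Matrix.map_apply, Matrix.of_apply, hM]
    · have hc : ((T5SplitUnitary.unitaryGroupEquivGL g)⁻¹ : GL ι F) = (T5SplitUnitary.toGL g)⁻¹ := rfl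
      rw [hc, T5SplitUnitary.coe_toGL_inv]
      ext i j
      rw [Matrix.transpose_apply, Matrix.map_apply, Matrix.transpose_apply, Matrix.of_apply, hM']

end Integral

section Hecke

variable {R : Type*} [CommRing R] [IsDomain R] [IsDiscreteValuationRing R]
  [Finite (IsLocalRing.ResidueField R)] {F : Type*} [Field F] [Algebra R F] [IsFractionRing R F]
  {ι : Type*} [Fintype ι] [DecidableEq ι]

/-- Every `K g K / K` is finite for `K = hyperspecialSplit R ⊂ U_n(F × F)`. -/
theorem finite_orbit_hyperspecialSplit (x : Matrix.unitaryGroup ι (T5SplitUnitary.SplitAlg F)) :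
    Finite (MulAction.orbit
      (hyperspecialSplit R : Subgroup (Matrix.unitaryGroup ι (T5SplitUnitary.SplitAlg F)))
      (x : Matrix.unitaryGroup ι (T5SplitUnitary.SplitAlg F) ⧸ hyperspecialSplit R)) :=
  T5GelfandTransport.finite_orbit_of_equiv T5SplitUnitary.unitaryGroupEquivGL
    (unitaryGroupEquivGL_mem_iff R) (fun g => T5HeckeAdjointGLn.finite_orbit g) x

/-- `H(U_n(F × F), K)` IS COMMUTATIVE for `K = hyperspecialSplit R`, `R` a DVR with finite residue field,
`F = Frac R` — the split place of the record in the model `E_v = F_v × F_v`, NO hypothesis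
(T5SplitPlaceHecke along `unitaryGroupEquivGL`). -/
theorem heckeAlgebra_mul_comm_hyperspecialSplit (k : Type*) [Field k]
    (T S : T5HeckePermutationModule.heckeAlgebra k (hyperspecialSplit R :
      Subgroup (Matrix.unitaryGroup ι (T5SplitUnitary.SplitAlg F)))) :
    T * S = S * T :=
  T5SplitPlaceHecke.heckeAlgebra_mul_comm_of_equiv k T5SplitUnitary.unitaryGroupEquivGL
    (unitaryGroupEquivGL_mem_iff R) T S

/-- Spherical multiplicity one for `U_n(F × F) ⊃ hyperspecialSplit R` — NO hypothesis. -/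
theorem finrank_invariants_eq_one_hyperspecialSplit {k : Type*} [Field k] [CharZero k] [IsAlgClosed k]
    {V : Type*} [AddCommGroup V] [Module k V]
    (ρ : Representation k (Matrix.unitaryGroup ι (T5SplitUnitary.SplitAlg F)) V) [ρ.IsIrreducible]
    (hKF : T5LevelIdempotent.KFinite ρ
      (hyperspecialSplit R : Subgroup (Matrix.unitaryGroup ι (T5SplitUnitary.SplitAlg F))))
    [FiniteDimensional k (LevelPositivity.invariants ρ (hyperspecialSplit R))]
    (hne : LevelPositivity.invariants ρ (hyperspecialSplit R) ≠ ⊥) :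
    Module.finrank k (LevelPositivity.invariants ρ (hyperspecialSplit R)) = 1 :=
  T5SphericalMultiplicityOneGLn.finrank_invariants_eq_one_of_equiv T5SplitUnitary.unitaryGroupEquivGL
    (unitaryGroupEquivGL_mem_iff R) ρ hKF hne

end Hecke

end Summit.Ventures.HodgeRepro2.T5SplitPlaceHyperspecial
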